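import Summits.CriticalPhenomena.PercolationContinuityZ3.Theorems.Transplant.FKConnectivityAllQForestNearTightPinnedEarsValid
import HarnessLib

/-!
# THE EARS THEOREM WITH PINNED INSIDE PAIRS (assembly)

Support file (`--supports stmt-CriticalPhenomena-4575`), FK sub-lane `prim-bschramm-fk-1` (gen 22) of the post-continuity programme;
builds on p205010 (kernel theorem, internal audit signed; external expert review pending).  No definitions, no named facts, no sorries;
standard axioms.  Part 3 of 3: **`adjForestNoSq_fibre_of_ears_pinned`** — the node's inequality
`#(Fo ∩ {e, f ∈ ω}, Fo) ≤ #(Fo ∩ {e ∈ ω}, Fo ∩ {f ∈ ω})` on every fibre `(M, u₀)` carrying a gadget `E ⊆ M ∪ u₀` inside `U` with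
`2|U| ≤ |E ∩ M| + 2|E ∩ u₀| + 3` and two ears whose four pairs `e = ov, f = oy, r = vv', t = y'y` are free.  Same two-toggle
injection as `adjForestNoSq_fibre_of_ears`; the σ-freeness lemmas `ears_iota_image_mem`, `ears_swap_image_not_mem` of
`…NearTightEarsMain` are reused on the free sub-gadget `{e, f, r, t}`, and `ears_iota_valid_pinned` replaces `ears_iota_valid`.
Application (`…ForestAdjacentFanPinned`): fans with pinned (doubled) inner spokes and rims — the fan / locally-connected theorem on
every fibre, i.e. for every finite multigraph.
[cite: SempleWelsh2008, Conj. 1.1 (p. 2); Thm. 4.2 (p. 11)] [cite: Linusson2011, Prop. 2.6] [cite: Grimmett2006, §1.5 (p. 13)]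
-/

noncomputable section

namespace Summit.CriticalPhenomena.PercolationContinuityZ3.Theorems
namespace FK

open Set Literature.Probability.LatticeModels Literature.Probability.Percolation
open scoped Classical symmDiff

variable {V : Type*} [Fintype V]

section PinnedEarsMain

variable {M u₀ : BondConfig V} {U : Finset V} {E : Finset (Sym2 V)} {o v v' y' y : V}

variable (hd : Disjoint u₀ M) (hEMu : ∀ g ∈ E, g ∈ M ∨ g ∈ u₀) (hEU : ∀ g ∈ E, ∀ w ∈ g, w ∈ U)
  (hcard : 2 * U.card ≤ (E.filter fun g => g ∈ M).card + 2 * (E.filter fun g => g ∈ u₀).card + 3)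
  (heE : s(o, v) ∈ E) (hfE : s(o, y) ∈ E) (hrE : s(v, v') ∈ E) (htE : s(y', y) ∈ E)
  (hve : ∀ g ∈ E, v ∈ g → g = s(o, v) ∨ g = s(v, v')) (hye : ∀ g ∈ E, y ∈ g → g = s(o, y) ∨ g = s(y', y))
  (hov : o ≠ v) (hoy : o ≠ y) (hvy : v ≠ y) (hvv' : v ≠ v') (hyy' : y ≠ y') (hv'y : v' ≠ y) (hvy' : v ≠ y')
include hd hEMu hEU hcard heE hfE hrE htE hve hye hov hoy hvy hvv' hyy' hv'y hvy'

/-- **THE EARS THEOREM WITH PINNED INSIDE PAIRS.**  On every fibre `(M, u₀)` carrying a near-tight gadget with two ears — inside pairs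
`E ⊆ M ∪ u₀` with ends in the finite vertex set `U`, `2|U| ≤ |E ∩ M| + 2|E ∩ u₀| + 3`, the ear pairs `e, f, r, t` free, `e = ov, f = oy ∈ E`, the `E`-pairs at `v` exactly `e` and `r = vv'`, the
`E`-pairs at `y` exactly `f` and `t = y'y`, with `o, v, v'` distinct, `o ≠ y ≠ y'`, `v ≠ y`, `v' ≠ y`, `v ≠ y'` — the square-free
adjacent forest Rayleigh inequality holds: `#(Fo ∩ {e, f ∈ ω}, Fo) ≤ #(Fo ∩ {e ∈ ω}, Fo ∩ {f ∈ ω})`.  In words: in the uniform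
ordered two-forest partition of a finite multigraph, `ov` and `oy` are negatively correlated as soon as `v` and `y` are ears
(inside degree two) of a near-tight set of free pairs through `ov, oy` — e.g. the ends of a path of neighbours of `o` (fans:
`…ForestAdjacentFan`), or degree-two vertices of any Laman graph through `o`.  Proof: the two-toggle rule, see the file header.
[cite: SempleWelsh2008, Conj. 1.1 (p. 2); Thm. 4.2 (p. 11)] [cite: Linusson2011, Prop. 2.6] [cite: Grimmett2006, §1.5 (p. 13)] -/
theorem adjForestNoSq_fibre_of_ears_pinned (heM : s(o, v) ∈ M) (hfM : s(o, y) ∈ M) (hrM : s(v, v') ∈ M)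
    (htM : s(y', y) ∈ M) :
    fibreCount M u₀ (forestEv V ∩ {ω | s(o, v) ∈ ω ∧ s(o, y) ∈ ω}) (forestEv V) ≤
      fibreCount M u₀ (forestEv V ∩ {ω | s(o, v) ∈ ω}) (forestEv V ∩ {ω | s(o, y) ∈ ω}) := by
  -- the four free ear pairs as a gadget of their own (for the image lemmas of `…NearTightEarsMain`)
  have hE4M : ∀ g ∈ ({s(o, v), s(o, y), s(v, v'), s(y', y)} : Finset (Sym2 V)), g ∈ M := by
    intro g hg
    simp only [Finset.mem_insert, Finset.mem_singleton] at hg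
    rcases hg with rfl | rfl | rfl | rfl
    · exact heM
    · exact hfM
    · exact hrM
    · exact htM
  have he4 : s(o, v) ∈ ({s(o, v), s(o, y), s(v, v'), s(y', y)} : Finset (Sym2 V)) := by simp
  have hf4 : s(o, y) ∈ ({s(o, v), s(o, y), s(v, v'), s(y', y)} : Finset (Sym2 V)) := by simp
  have hr4 : s(v, v') ∈ ({s(o, v), s(o, y), s(v, v'), s(y', y)} : Finset (Sym2 V)) := by simp
  have ht4 : s(y', y) ∈ ({s(o, v), s(o, y), s(v, v'), s(y', y)} : Finset (Sym2 V)) := by simp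
  have hef : s(o, v) ≠ s(o, y) := fun h' => hvy (Sym2.congr_right.1 h')
  -- the separating event and the validity event
  set P : Set (BondConfig V) := {C : BondConfig V | s(y', y) ∈ C ∧ IsForestCfg (insert s(o, y) (C \ {s(y', y)})) ∧
    (s(v, v') ∈ C ∨ (openGraph (insert s(o, y) (C \ {s(y', y)}) \ {s(o, v)})).Reachable v v' ∨
      (openGraph (insert s(y', y) ((C ∆ M) \ {s(o, y)}) \ {s(v, v')})).Reachable o v)} with hP
  set Val : Set (BondConfig V) := {ω : BondConfig V | s(v, v') ∉ ω ∧ ¬ (openGraph (ω \ {s(o, v)})).Reachable v v' ∧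
    ¬ (openGraph ((ω ∆ M) \ {s(v, v')})).Reachable o v} with hVal
  have s1 := fibreCount_split_pred M u₀ (forestEv V ∩ {ω | s(o, v) ∈ ω ∧ s(o, y) ∈ ω}) (forestEv V) Val
  have t1 := fibreCount_split_pred M u₀ (forestEv V ∩ {ω | s(o, v) ∈ ω}) (forestEv V ∩ {ω | s(o, y) ∈ ω}) P
  -- valid: `ι'` then the class swap, landing outside `P`
  have h1 : fibreCount M u₀ (forestEv V ∩ {ω | s(o, v) ∈ ω ∧ s(o, y) ∈ ω} ∩ Val) (forestEv V) ≤
      fibreCount M u₀ (forestEv V ∩ {ω | s(o, v) ∈ ω} ∩ Pᶜ) (forestEv V ∩ {ω | s(o, y) ∈ ω}) := by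
    refine le_trans (fibreCount_exchange_le_of heM hrM (A' := forestEv V ∩ {ω | s(o, y) ∈ ω})
      (B' := forestEv V ∩ {ω | s(o, v) ∈ ω} ∩ Pᶜ) fun ω _ hA hB => ?_) (le_of_eq (fibreCount_swap _ _ _ _))
    obtain ⟨⟨hF, he, hf⟩, hr, hR1, hR2⟩ := hA
    have hF' : IsForestCfg (ω ∆ M) := hB
    have heB : s(o, v) ∉ (ω ∆ M) \ {s(v, v')} := fun h => (mem_symmDiff_iff_not_mem heM).1 h.1 he
    refine ⟨he, hr, ⟨?_, mem_insert_of_mem _ ⟨hf, hef.symm⟩⟩, ⟨?_, mem_insert _ _⟩, ?_⟩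
    · exact (isForestCfg_insert_iff hvv' fun h => hr h.1).2 ⟨isForestCfg_of_subset hF sdiff_subset, hR1⟩
    · exact (isForestCfg_insert_iff hov heB).2 ⟨isForestCfg_of_subset hF' sdiff_subset, hR2⟩
    · exact ears_swap_image_not_mem hE4M he4 hf4 hr4 ht4 hov hoy hvy hvv' hvy' hF hF' he hf hr hR2
  -- invalid: `ι`, landing inside `P`
  have h2 : fibreCount M u₀ (forestEv V ∩ {ω | s(o, v) ∈ ω ∧ s(o, y) ∈ ω} ∩ Valᶜ) (forestEv V) ≤
      fibreCount M u₀ (forestEv V ∩ {ω | s(o, v) ∈ ω} ∩ P) (forestEv V ∩ {ω | s(o, y) ∈ ω}) := by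
    refine fibreCount_exchange_le_of hfM htM fun ω hω hA hB => ?_
    obtain ⟨⟨hF, he, hf⟩, hinv⟩ := hA
    have hF' : IsForestCfg (ω ∆ M) := hB
    obtain ⟨ht, hR1, hR2⟩ :=
      ears_iota_valid_pinned hd hEMu hEU hcard heE hfE hrE htE hve hye hov hoy hvy hvv' hyy' hv'y hvy' heM hfM hrM htM hω hF
        hF' he hf hinv
    have hfB : s(o, y) ∉ (ω ∆ M) \ {s(y', y)} := fun h => (mem_symmDiff_iff_not_mem hfM).1 h.1 hf
    refine ⟨hf, ht, ⟨⟨?_, mem_insert_of_mem _ ⟨he, hef⟩⟩, ?_⟩, ?_, mem_insert _ _⟩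
    · exact (isForestCfg_insert_iff hyy'.symm fun h => ht h.1).2 ⟨isForestCfg_of_subset hF sdiff_subset, hR1⟩
    · exact ears_iota_image_mem hE4M hf4 ht4 hov hvy hvy' hF hf ht hinv
    · exact (isForestCfg_insert_iff hoy hfB).2 ⟨isForestCfg_of_subset hF' sdiff_subset, hR2⟩
  omega


end PinnedEarsMain

end FK
end Summit.CriticalPhenomena.PercolationContinuityZ3.Theorems

end
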